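import Literature.NumberTheory.Sieve.AsymptoticSieveForPrimesDecomposition
import HarnessLib

/-!
# Asymptotic sieve for primes with the bilinear hypothesis `(B*)` (rough inner variable): hypotheses and Theorem 1 under (B*) (the reduction of §10)

Trunk T-SIEVE, family `parity`. Source: J. Friedlander, H. Iwaniec, *Asymptotic sieve for primes*,
Ann. of Math. 148 (1998) 1041–1065 [FriedlanderIwaniecASP1998], §10 "A reduction of the bilinear
form" ((10.1), (10.2), (B*), Theorem 3, pp. 1063–1065) on top of §§1–8 (Theorem 1); and
J. Friedlander, H. Iwaniec, *The polynomial `X² + Y⁴` captures its primes*, ibid. 945–1040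
[FriedlanderIwaniecAnnals1998], Proposition 2.1 ((2.11)–(2.15): the same hypothesis `(B*)`).

## Why this file exists

The tree PROVES FI's Theorem 1 in its working regime (`Literature.NumberTheory.Sieve.fi_asymptotic_sieve_primes_loglog`,
`…AsymptoticSieveForPrimesLoglog`: from `fi_moebius_density_cancellation`, itself proved in
`…Cancellation`): a squarefree-supported sequence with (1.4), (1.6), (1.8), (1.9), (R) and the
bilinear hypothesis
(B) `∑_m |∑_{N<n≤2N, mn≤x} γ(n,C) μ(mn) a_{mn}| ≤ A(x)(log x)^{-2^{22}}` (pointwise in `N`, `C`)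
satisfies `∑_{p≤x} a_p log p = HA(x)(1 + O(log log x/log x))`. The application to `X² + Y⁴`
([FriedlanderIwaniecAnnals1998] Prop. 2.1 = [FriedlanderIwaniecASP1998] Theorem 3, applied in the
tree to the squarefree-supported sequence `μ²(n) a_n`, `…FriedlanderIwaniecPrimesSquarefreeProofs`)
needs instead FI's hypothesis
(B*) the same bound with saving `(log x)^{-2^{26}}` but with the inner variable `n` restricted to
integers free of prime factors `< P`, `Π = ∏_{p<P} p`, for a parameter `2 ≤ P ≤ Δ^{1/(2^{35} log log x)}`
((10.1)–(10.2)), because FI's Proposition 4.1 bounds the bilinear form only with this restriction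
(with `log P ≥ (log log x)²`). FI, §10: "Theorem 3. Replace (B) by (B*) in the assumptions of
Theorem 2. Then (1.17) still holds. For the proof it is enough to show that (B*) implies (B) with
`δ, Δ` replaced by `2δ, 2Δ²`. Furthermore we only need to establish (B) in the following integrated
form (B̃) … recall that (B) was used solely to estimate the sums `S₂` and `S₃` in Sections 7 and 8."
(Pointwise, (B) does NOT follow from (B*): splitting `n = n₀n₁`, `n₁ ∣ Π`, costs a factor
`#{n₁ ∣ Π : n₁ ≤ Δ} ≥ π(P)`, larger than any power of `log x` once `log P ≥ (log log x)²`; the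
integration over `N` and `C` is what absorbs the shifts `N → N/n₁`, `C → C/d₁`.)

This file fixes the LANGUAGE of that variant over the tree's `SieveSequence` API, so that FI's §10
can be formalised against the tree's proof of Theorem 1 (whose term estimates (4.5), (5.1), (6.6)
do not use (B) at all, while (7.2), (8.5) use it only after an integration over `y`, resp. `z`):

* `SieveSequence.fiBilinearRough A x N C P` — the bilinear form of (B*):
  `∑_{1≤m≤x} |∑_{N<n≤2N, mn≤x, (n,Π)=1} γ(n,C) μ(mn) a_{mn}|`, `(n, Π) = 1` written as
  "every prime factor of `n` is `≥ P`" (so `P ≤ 2` is no restriction: `fiBilinearRough_of_le_two`);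
* `SieveSequence.FIAsymptoticSieveHypothesesCore A D` — the clauses of
  `SieveSequence.FIAsymptoticSieveHypotheses` that do not mention `δ, Δ` or (B): `size_eq`, (1.4),
  (1.6), (1.8), (1.9), (1.16), (R1) `x^{2/3} < D < x`, (R); with the two projections
  `FIAsymptoticSieveHypotheses.core`, `FIAsymptoticSieveHypothesesRough.core` and the embedding
  `FIAsymptoticSieveHypothesesCore.withTrivialBilinear : Core → FIAsymptoticSieveHypotheses A D (2√·) 2`
  (for `δ = 2√x`, `Δ = 2` the range (B1) `Δ⁻¹√D < N < δ⁻¹√x = 1/2` contains no `N` with an integer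
  in `(N, 2N]`, so clause (B) holds with all inner sums empty — the documented degenerate case of the
  literal (B), see `Literature.NumberTheory.Sieve.fi_asymptotic_sieve_primes`; this lets every tree lemma keyed on
  `FIAsymptoticSieveHypotheses A D δ Δ` with `δ, Δ` free — (R) ⟹ (R′), the `T`-identities, … — be
  applied to a sequence satisfying only the core clauses);
* `SieveSequence.FIAsymptoticSieveHypothesesRough A D δ Δ P` — Core ∧ (`δ, Δ ≥ 2`, (10.2)
  `2 ≤ P ≤ Δ^{1/(2^{35} log log x)}`) ∧ (B*) in the ranges (B1), (B3) with saving `(log x)^{-2^{26}}`: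
  the hypotheses of Theorem 1 with (B) replaced by (B*) and (10.2) added, i.e. exactly what FI's
  PROOF of Theorem 3 (§10, pp. 1063–1064) consumes for a squarefree-supported sequence. This is
  NOT the printed hypothesis set of Theorem 3 (= that of Theorem 2: (1.4), (1.6), (1.8), (1.9),
  (B*), (B1)–(B3), (9.1), (9.2), (R₃), (R1)): the clauses (9.1) `g(p²) ≤ g(p)`, (9.2)
  `∑ a_n² ≤ x^{-2/3}A(x)²` and the surplus of (R₃) over (R) (cubefree moduli up to `DL²`, saving
  `L⁻²`, `L = (log x)^{2^{24}}`) are DROPPED, because they serve only the reduction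
  `a_n ↦ μ²(n)a_n` of §9 and Theorem 1's proof, which §10 re-enters at (7.1) and (8.1), never uses
  them;
* `FIRegimeCore A D δ Δ α θ θ₁ lam` — `FIRegime` with the hypothesis field decoupled from the regime
  exponents (`hyp : A.FIAsymptoticSieveHypotheses D δ Δ` for arbitrary `δ, Δ`), `FIRegime.toCore`;
  `FIRegimeRough A D α θ θ₁ lam P` (hypotheses `…Rough D (log^α) (x^θ) P`) and
  `FIRegimeRough.toCore` (through `withTrivialBilinear`);
* the term estimates restated over these regimes, as `Prop`s to be discharged by the sequel files:
  `fi_asp_T_estimate_core` (4.5), `fi_asp_Tyz_estimate_core` (5.1), `fi_asp_S1_estimate_core` (6.6)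
  — each implying the tree's version (`….to_estimate`), their printed proofs being free of (B) — and
  `fi_asp_S2_estimate_rough` (7.2), `fi_asp_S3_estimate_rough` (8.5) under (B*) via (B̃) (§10);
* the named fact `fi_asymptotic_sieve_primes_rough_loglog`: **Theorem 1 of
  [FriedlanderIwaniecASP1998] with (B) replaced by (B*)** — the statement FI establish in §10
  (pp. 1063–1064) in the course of proving Theorem 3 ("it is enough to show that (B*) implies (B)
  … in the following integrated form (B̃) … (B) was used solely to estimate the sums `S₂` and `S₃`");
  it is the case of [FriedlanderIwaniecAnnals1998] Proposition 2.1 that the tree applies (to the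
  squarefree-supported `μ²(n)a_n`), in the regime `δ = (log x)^α`, `Δ = x^θ`, `0 < θ < 1/3`, error
  `O(log log x / log x)`. Being free of (9.1), (9.2), (R₃) it is NOT implied by the printed Theorem 3;
  its justification is the printed PROOF (Theorem 1, proved in the tree, plus §10), formalised in the
  sequel files.

Faithfulness of the clauses: (B*) is demanded with an explicit constant `1` and FI's exponent
`2^{26}` where the print (p. 1063) has "`≪ A(x)(log x)^{-2^{26}}`" — a STRONGER hypothesis, hence a
weaker statement (the convention of the tree's `FI1998SieveHypotheses` (2.11)); (10.2) and the
ranges (B1), (B3) are as printed; the conclusion is (1.17) in the regime FI name (p. 1044), exactly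
as for `fi_asymptotic_sieve_primes_loglog`. The two printings of the restricted bilinear form —
`γ(n,C)μ(mn)a_{mn}` over `(n, Π) = 1` here ((B*) of [FriedlanderIwaniecASP1998]) versus
`μ(n)γ(n,C)a_{mn}` over `(n, mΠ) = 1` in `SieveSequence.fiBilinearPi` ((2.11) of
[FriedlanderIwaniecAnnals1998]) — agree only on squarefree support (off it, `μ(mn) = 0` for
`(m,n) > 1` while `a_{mn}` need not vanish); the comparison `fiBilinearRough ≤ fiBilinearPi` under
(1.16) is proved in the sequel `…FriedlanderIwaniecPrimesRough`.

## References

* J. Friedlander, H. Iwaniec, *Asymptotic sieve for primes*, Ann. of Math. 148 (1998), 1041–1065,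
  §10: (10.1), (10.2), (B*), Theorem 3, (B̃), (10.3)–(10.5). [cite: FriedlanderIwaniecASP1998, §10 Theorem 3]
* J. Friedlander, H. Iwaniec, *The polynomial `X² + Y⁴` captures its primes*, Ann. of Math. 148
  (1998), 945–1040, §2, (2.11)–(2.15), Proposition 2.1. [cite: FriedlanderIwaniecAnnals1998, Proposition 2.1]

## Mathlib / tree search

Tree: `SieveSequence.fiBilinear`, `fiGamma`, `fiLogSaving`, `FIAsymptoticSieveHypotheses`
(`…AsymptoticSieveForPrimes`), `FIRegime`, `fiY`, `IsFISplit`, `fiSieveDensity`, `fiT`, `fiTyz`,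
`fiS1`, `fiS2Y`, `fiS3Z`, the five `fi_asp_*_estimate` (`…Decomposition`), `IsUpperSieveWeights`
(`…Inputs`), `primesProdBelow` (`SieveFramework`); `SieveSequence.fiBilinearPi`
(`…FriedlanderIwaniecPrimes`, FI (2.11) with `β(n) a_{mn}`, compared with `fiBilinearRough` in the
sequel `…FriedlanderIwaniecPrimesRough`). `lean search 'Rough|BilinearStar|Theorem 3'` in the ASP
files: nothing (the docstring of `FIAsymptoticSieveHypotheses` records that Theorems 2–3 were not
vendored).
-/

noncomputable section

open Filter Asymptotics Finset
open scoped ArithmeticFunction.Moebius ArithmeticFunction.sigma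

namespace Literature.NumberTheory.Sieve

namespace SieveSequence

/-! ### The bilinear form of (B*) -/

/-- FI's bilinear form with the inner variable restricted to integers free of prime factors `< P`
((10.1): `(n, Π) = 1`, `Π = ∏_{p<P} p`):
`B*(x; N, C, P) = ∑_{1≤m≤x} |∑_{N<n≤2N, mn≤x, (n,Π)=1} γ(n,C) μ(mn) a_{mn}|`.
[cite: FriedlanderIwaniecASP1998, §10 (10.1) and (B*)] -/
def fiBilinearRough (A : SieveSequence) (x N C P : ℝ) : ℝ :=
  ∑ m ∈ Icc 1 ⌊x⌋₊,
    |∑ n ∈ (Ioc ⌊N⌋₊ ⌊2 * N⌋₊).filter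
        (fun n : ℕ => ((m * n : ℕ) : ℝ) ≤ x ∧ ∀ p ∈ n.primeFactors, P ≤ (p : ℝ)),
      (fiGamma C n : ℝ) * (μ (m * n) : ℝ) * A.a (m * n)|

/-- `fiBilinearRough` unfolded. [cite: FriedlanderIwaniecASP1998, §10 (B*)] -/
theorem fiBilinearRough_def (A : SieveSequence) (x N C P : ℝ) :
    A.fiBilinearRough x N C P = ∑ m ∈ Icc 1 ⌊x⌋₊,
      |∑ n ∈ (Ioc ⌊N⌋₊ ⌊2 * N⌋₊).filter
          (fun n : ℕ => ((m * n : ℕ) : ℝ) ≤ x ∧ ∀ p ∈ n.primeFactors, P ≤ (p : ℝ)),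
        (fiGamma C n : ℝ) * (μ (m * n) : ℝ) * A.a (m * n)| := rfl

/-- `B* ≥ 0` (a sum of absolute values). [folklore] -/
theorem fiBilinearRough_nonneg (A : SieveSequence) (x N C P : ℝ) : 0 ≤ A.fiBilinearRough x N C P :=
  Finset.sum_nonneg fun _ _ => abs_nonneg _

/-- For `P ≤ 2` the roughness condition is void and `B*(x; N, C, P) = B(x; N, C)`
(`Π = 1` "is permissible", [FriedlanderIwaniecAnnals1998] §4). [folklore] -/
theorem fiBilinearRough_of_le_two (A : SieveSequence) (x N C : ℝ) {P : ℝ} (hP : P ≤ 2) :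
    A.fiBilinearRough x N C P = A.fiBilinear x N C := by
  rw [fiBilinearRough, fiBilinear]
  refine Finset.sum_congr rfl fun m _ => ?_
  congr 1
  refine Finset.sum_congr ?_ fun _ _ => rfl
  refine Finset.filter_congr fun n _ => ?_
  constructor
  · exact fun h => h.1
  · intro h
    refine ⟨h, fun p hp => hP.trans ?_⟩
    exact_mod_cast (Nat.prime_of_mem_primeFactors hp).two_le

/-! ### The hypotheses without the bilinear clause -/

/-- **The clauses of FI's Theorem 1 that do not involve the bilinear form** (the conjunction
`SieveSequence.FIAsymptoticSieveHypotheses` with its parameters `δ, Δ` and clause (B) removed):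
`size_eq`, (1.4) `A(x) ≫ A(√x)(log x)²`, (1.6) `A_d(x) ≪ d⁻¹τ(d)⁸A(x)` (`d ≤ x^{1/3}`),
(1.8) `0 ≤ g(p) < 1`, `g(p) ≪ 1/p`, (1.9) `∑_{p≤y} g(p) = log log y + c + O((log y)^{-10})`,
(1.16) squarefree support, (R1) `x^{2/3} < D(x) < x`, (R) `∑_{d≤D, d sqfree} |r_d(t)| ≤ A(x)(log x)^{-2^{22}}`
(`t ≤ x`), the `x`-local clauses for all large `x`.
[cite: FriedlanderIwaniecASP1998, §1 (1.4), (1.6)-(1.9), (1.16), (R), (R1)] -/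
def FIAsymptoticSieveHypothesesCore (A : SieveSequence) (D : ℝ → ℝ) : Prop :=
  (∀ x, A.size x = A.congrSum 1 x) ∧
  (∃ c : ℝ, 0 < c ∧ ∀ᶠ x : ℝ in atTop, c * A.size (Real.sqrt x) * Real.log x ^ 2 ≤ A.size x) ∧
  (∃ K : ℝ, ∀ᶠ x : ℝ in atTop, ∀ d : ℕ, 1 ≤ d → (d : ℝ) ≤ x ^ (1 / 3 : ℝ) →
    A.congrSum d x ≤ K * (σ 0 d : ℝ) ^ 8 / d * A.size x) ∧
  (∃ K : ℝ, ∀ p : ℕ, p.Prime → 0 ≤ A.density p ∧ A.density p < 1 ∧ A.density p ≤ K / p) ∧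
  (∃ c K : ℝ, ∀ y : ℝ, 2 ≤ y →
    |(∑ p ∈ Nat.primesLE ⌊y⌋₊, A.density p) - (Real.log (Real.log y) + c)| ≤
      K / Real.log y ^ 10) ∧
  (∀ n : ℕ, ¬Squarefree n → A.a n = 0) ∧
  (∀ᶠ x : ℝ in atTop, x ^ (2 / 3 : ℝ) < D x ∧ D x < x) ∧
  (∀ᶠ x : ℝ in atTop, ∀ t : ℝ, t ≤ x →
    ∑ d ∈ (Icc 1 ⌊D x⌋₊).filter Squarefree, |A.remainder d t| ≤
      A.size x / Real.log x ^ fiLogSaving)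

/-- The hypotheses of Theorem 1 contain the core clauses. [folklore] -/
theorem FIAsymptoticSieveHypotheses.core {A : SieveSequence} {D δ Δ : ℝ → ℝ}
    (h : A.FIAsymptoticSieveHypotheses D δ Δ) : A.FIAsymptoticSieveHypothesesCore D := by
  obtain ⟨h1, h2, h3, h4, h5, h6, h7, h8, -⟩ := h
  exact ⟨h1, h2, h3, h4, h5, h6, h7.mono fun x hx => ⟨hx.1, hx.2.1⟩, h8⟩

/-- **The embedding with a void bilinear clause.** The core clauses imply the literal conjunction
`FIAsymptoticSieveHypotheses A D δ Δ` for `δ(x) = 2√x`, `Δ(x) = 2`: then (B1) reads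
`√D/2 < N < 1/2`, and for `N < 1/2` the inner range `(⌊N⌋, ⌊2N⌋] = (0, 0]` is empty, so every
bilinear form in clause (B) vanishes. (This is the degenerate case of the literal (B) documented at
`Literature.NumberTheory.Sieve.fi_asymptotic_sieve_primes`; it is used only to feed tree lemmas whose statements are keyed on
`FIAsymptoticSieveHypotheses A D δ Δ` with `δ, Δ` free and whose content does not involve (B).)
[folklore] -/
theorem FIAsymptoticSieveHypothesesCore.withTrivialBilinear {A : SieveSequence} {D : ℝ → ℝ}
    (h : A.FIAsymptoticSieveHypothesesCore D) :
    A.FIAsymptoticSieveHypotheses D (fun x => 2 * Real.sqrt x) (fun _ => 2) := by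
  obtain ⟨h1, h2, h3, h4, h5, h6, h7, h8⟩ := h
  refine ⟨h1, h2, h3, h4, h5, h6, ?_, h8, ?_⟩
  · filter_upwards [h7, eventually_ge_atTop (1 : ℝ)] with x hx hx1
    refine ⟨hx.1, hx.2, ?_, le_rfl⟩
    have : 1 ≤ Real.sqrt x := by rw [Real.le_sqrt (by norm_num) (by linarith)]; simpa using hx1
    linarith
  · filter_upwards [eventually_ge_atTop (1 : ℝ)] with x hx1
    intro N _ hN C _ _
    have hx0 : 0 < x := by linarith
    have hs : 0 < Real.sqrt x := Real.sqrt_pos.mpr hx0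
    have hN2 : N < 1 / 2 := by
      calc N < Real.sqrt x / (2 * Real.sqrt x) := hN
        _ = 1 / 2 := by field_simp
    have hempty : Ioc ⌊N⌋₊ ⌊2 * N⌋₊ = ∅ := by
      have h2N : ⌊2 * N⌋₊ = 0 := Nat.floor_eq_zero.mpr (by linarith)
      rw [h2N]
      exact Finset.Ioc_eq_empty (by omega)
    have hB : A.fiBilinear x N C = 0 := by
      rw [fiBilinear]
      refine Finset.sum_eq_zero fun m _ => ?_
      rw [hempty, Finset.filter_empty, Finset.sum_empty, abs_zero]
    rw [hB]
    have := A.congrSum_nonneg 1 x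
    rw [← h1] at this
    exact div_nonneg this (pow_nonneg (Real.log_nonneg hx1) _)

/-! ### The hypotheses of Theorem 1 with (B*) in place of (B) -/

/-- **The hypotheses of FI's asymptotic sieve with the bilinear clause (B*)** for a sifted
sequence `A` with level function `D`, bilinear-range parameters `δ, Δ` and sieving parameter `P`:
the core clauses (`FIAsymptoticSieveHypothesesCore`: `size_eq`, (1.4), (1.6), (1.8), (1.9), (1.16),
(R1), (R)), the parameter conditions `δ(x), Δ(x) ≥ 2` and (10.2) `2 ≤ P(x) ≤ Δ(x)^{1/(2^{35} log log x)}`,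
and
(B*) `∑_m |∑_{N<n≤2N, mn≤x, (n,Π)=1} γ(n,C) μ(mn) a_{mn}| ≤ A(x)(log x)^{-2^{26}}` for every
`Δ⁻¹√D < N < δ⁻¹√x` (B1) and `1 ≤ C ≤ x/D` (B3), all for sufficiently large `x` — the print
(p. 1063) has "`≪`" in (B*); the explicit constant `1` is a stronger hypothesis. These are the
assumptions of Theorem 1 with (B) replaced by (B*) plus (10.2), i.e. what the PROOF of
[FriedlanderIwaniecASP1998] Theorem 3 (§10) consumes for a squarefree-supported sequence; the printed
hypotheses of Theorem 3 (= those of Theorem 2) contain in addition (9.1), (9.2)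
`∑ a_n² ≤ x^{-2/3}A(x)²` and (R₃) (cubefree `d < DL²`, saving `L⁻²`, `L = (log x)^{2^{24}}`, of which
only the part (R) — squarefree `d ≤ D`, saving `(log x)^{-2^{22}}` — is kept here): those serve the
reduction `a_n ↦ μ²(n)a_n` of §9 and are not used by Theorem 1's proof. In the language of
[FriedlanderIwaniecAnnals1998] Proposition 2.1 these are (2.1), (2.3)–(2.5), (2.7), (2.8),
(2.10)–(2.15) with (2.9) weakened to (R), for a sequence with (1.16).
[cite: FriedlanderIwaniecASP1998, §10 (10.1)-(10.2), (B*); §1 (R), (B1), (B3)] -/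
def FIAsymptoticSieveHypothesesRough (A : SieveSequence) (D δ Δ P : ℝ → ℝ) : Prop :=
  A.FIAsymptoticSieveHypothesesCore D ∧
  (∀ᶠ x : ℝ in atTop, 2 ≤ δ x ∧ 2 ≤ Δ x ∧ 2 ≤ P x ∧
    P x ≤ Δ x ^ (1 / (2 ^ 35 * Real.log (Real.log x)))) ∧
  (∀ᶠ x : ℝ in atTop, ∀ N : ℝ, Real.sqrt (D x) / Δ x < N → N < Real.sqrt x / δ x →
    ∀ C : ℝ, 1 ≤ C → C ≤ x / D x →
      A.fiBilinearRough x N C (P x) ≤ A.size x / Real.log x ^ (2 ^ 26 : ℕ))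

/-- Projection onto the core clauses. [folklore] -/
theorem FIAsymptoticSieveHypothesesRough.core {A : SieveSequence} {D δ Δ P : ℝ → ℝ}
    (h : A.FIAsymptoticSieveHypothesesRough D δ Δ P) : A.FIAsymptoticSieveHypothesesCore D :=
  h.1

/-- The parameter clause: `δ, Δ ≥ 2` and (10.2). [cite: FriedlanderIwaniecASP1998, §10 (10.2)] -/
theorem FIAsymptoticSieveHypothesesRough.params {A : SieveSequence} {D δ Δ P : ℝ → ℝ}
    (h : A.FIAsymptoticSieveHypothesesRough D δ Δ P) :
    ∀ᶠ x : ℝ in atTop, 2 ≤ δ x ∧ 2 ≤ Δ x ∧ 2 ≤ P x ∧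
      P x ≤ Δ x ^ (1 / (2 ^ 35 * Real.log (Real.log x))) :=
  h.2.1

/-- The bilinear clause (B*). [cite: FriedlanderIwaniecASP1998, §10 (B*)] -/
theorem FIAsymptoticSieveHypothesesRough.bilinear {A : SieveSequence} {D δ Δ P : ℝ → ℝ}
    (h : A.FIAsymptoticSieveHypothesesRough D δ Δ P) :
    ∀ᶠ x : ℝ in atTop, ∀ N : ℝ, Real.sqrt (D x) / Δ x < N → N < Real.sqrt x / δ x →
      ∀ C : ℝ, 1 ≤ C → C ≤ x / D x →
        A.fiBilinearRough x N C (P x) ≤ A.size x / Real.log x ^ (2 ^ 26 : ℕ) :=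
  h.2.2

/-- The size normalisation: `A.size x = ∑_{n ≤ x} a_n`. [folklore] -/
theorem FIAsymptoticSieveHypothesesRough.size_eq {A : SieveSequence} {D δ Δ P : ℝ → ℝ}
    (h : A.FIAsymptoticSieveHypothesesRough D δ Δ P) (x : ℝ) : A.size x = A.congrSum 1 x :=
  h.1.1 x

/-- The squarefree-support clause (1.16). [cite: FriedlanderIwaniecASP1998, (1.16)] -/
theorem FIAsymptoticSieveHypothesesRough.a_eq_zero {A : SieveSequence} {D δ Δ P : ℝ → ℝ}
    (h : A.FIAsymptoticSieveHypothesesRough D δ Δ P) {n : ℕ} (hn : ¬Squarefree n) : A.a n = 0 :=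
  h.1.2.2.2.2.2.1 n hn

/-- A sequence satisfying the rough hypotheses satisfies the literal hypotheses of Theorem 1 with
the void bilinear parameters `δ = 2√x`, `Δ = 2` (`FIAsymptoticSieveHypothesesCore.withTrivialBilinear`).
[folklore] -/
theorem FIAsymptoticSieveHypothesesRough.withTrivialBilinear {A : SieveSequence} {D δ Δ P : ℝ → ℝ}
    (h : A.FIAsymptoticSieveHypothesesRough D δ Δ P) :
    A.FIAsymptoticSieveHypotheses D (fun x => 2 * Real.sqrt x) (fun _ => 2) :=
  h.core.withTrivialBilinear

end SieveSequence

/-! ### Regimes -/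

/-- **The regime of the proof of Theorem 1, with the hypothesis field decoupled from the exponents.**
As `FIRegime A D α θ θ₁ lam` (fixed `α > 0`, `0 < θ < 1/3`, `0 < θ₁ ≤ θ/2`, upper-bound sieve
weights `lam x` of sifting range `x^{θ₁}` and level `x^{θ/2}` for large `x`), except that the
hypotheses of Theorem 1 are demanded for ARBITRARY parameter functions `δ, Δ` rather than for
`δ = (log x)^α`, `Δ = x^θ`. The estimates (4.5), (5.1), (6.6) of FI §§4–6 hold in this generality
(their proofs use (1.4)–(1.9), (1.16), (R), (R1) and the weights, never (B)), which is how they are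
made available under (B*). [cite: FriedlanderIwaniecASP1998, §1 p. 1044 and §3 (3.3)] -/
structure FIRegimeCore (A : SieveSequence) (D δ Δ : ℝ → ℝ) (α θ θ₁ : ℝ) (lam : ℝ → ℕ → ℤ) :
    Prop where
  /-- `α > 0`. -/
  α_pos : 0 < α
  /-- `θ₁ > 0`. -/
  θ₁_pos : 0 < θ₁
  /-- `θ₁ ≤ θ/2` (sifting range at most the level). -/
  θ₁_le : θ₁ ≤ θ / 2
  /-- `θ < 1/3`. -/
  θ_lt : θ < 1 / 3
  /-- The hypotheses of Theorem 1 for some parameter functions `δ, Δ`. -/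
  hyp : A.FIAsymptoticSieveHypotheses D δ Δ
  /-- Upper-bound sieve weights of sifting range `x^{θ₁}` and level `x^{θ/2}` for large `x`. -/
  weights : ∀ᶠ x : ℝ in atTop, IsUpperSieveWeights (x ^ θ₁) (x ^ (θ / 2)) (lam x)

/-- `FIRegime` is the case `δ = (log x)^α`, `Δ = x^θ` of `FIRegimeCore`. [folklore] -/
theorem FIRegime.toCore {A : SieveSequence} {D : ℝ → ℝ} {α θ θ₁ : ℝ} {lam : ℝ → ℕ → ℤ}
    (h : FIRegime A D α θ θ₁ lam) :
    FIRegimeCore A D (fun x => Real.log x ^ α) (fun x => x ^ θ) α θ θ₁ lam :=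
  ⟨h.α_pos, h.θ₁_pos, h.θ₁_le, h.θ_lt, h.hyp, h.weights⟩

/-- **The regime of the proof of Theorem 1 under (B*)** (§10): fixed exponents `α > 0` (`δ = (log x)^α`),
`0 < θ₁ ≤ θ/2`, a sieving-parameter function `P`, upper-bound sieve weights `lam x` of sifting
range `x^{θ₁}` and level `x^{θ/2}` for all large `x` (as in `FIRegime`), and the hypotheses
`FIAsymptoticSieveHypothesesRough A D (log^α) (x^{2θ}) P`, i.e. (B*) and (10.2) for the bilinear
parameter `Δ_B = x^{2θ}` — the SQUARE of the parameter `x^θ` for which `FIRegime` demands (B) —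
with `Δ_B` in the range of Theorem 1, `2θ < 1/3`. This is FI's "(B*) implies (B) with `δ, Δ`
replaced by `2δ, 2Δ²`" (§10): the change of variables `w → w n₁` (`n₁ ≤ Δ`) in (B̃) consumes (B*)
below the range where the integrated bound is used by §§7–8 (down to the lower end `Y/Δ = x^{-θ}√D`
of (7.1), `Y = x^{-θ/2}√D`, `Δ = x^{θ/2}`), so (B*) is needed for `N > x^{-3θ/2}√D`; and the
trivial treatment (10.4) of `n₁ > Δ` through (1.6) needs `x^{1/4} Δ P ≤ x^{1/3}`.
[cite: FriedlanderIwaniecASP1998, §10 Theorem 3 and §3 (3.3)] -/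
structure FIRegimeRough (A : SieveSequence) (D : ℝ → ℝ) (α θ θ₁ : ℝ) (lam : ℝ → ℕ → ℤ)
    (P : ℝ → ℝ) : Prop where
  /-- `α > 0`. -/
  α_pos : 0 < α
  /-- `θ₁ > 0`. -/
  θ₁_pos : 0 < θ₁
  /-- `θ₁ ≤ θ/2` (sifting range at most the level). -/
  θ₁_le : θ₁ ≤ θ / 2
  /-- `2θ < 1/3` (the bilinear parameter `x^{2θ}` is in the range of Theorem 1). -/
  θ_lt : θ < 1 / 6
  /-- The hypotheses with (B*) for `δ = (log x)^α`, `Δ_B = x^{2θ}` and the sieving parameter `P`. -/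
  hyp : A.FIAsymptoticSieveHypothesesRough D (fun x => Real.log x ^ α) (fun x => x ^ (2 * θ)) P
  /-- Upper-bound sieve weights of sifting range `x^{θ₁}` and level `x^{θ/2}` for large `x`. -/
  weights : ∀ᶠ x : ℝ in atTop, IsUpperSieveWeights (x ^ θ₁) (x ^ (θ / 2)) (lam x)

/-- A rough regime is a core regime with the void bilinear parameters `δ = 2√x`, `Δ = 2`.
[folklore] -/
theorem FIRegimeRough.toCore {A : SieveSequence} {D : ℝ → ℝ} {α θ θ₁ : ℝ} {lam : ℝ → ℕ → ℤ}
    {P : ℝ → ℝ} (h : FIRegimeRough A D α θ θ₁ lam P) :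
    FIRegimeCore A D (fun x => 2 * Real.sqrt x) (fun _ => 2) α θ θ₁ lam :=
  ⟨h.α_pos, h.θ₁_pos, h.θ₁_le, by linarith [h.θ_lt], h.hyp.withTrivialBilinear, h.weights⟩

/-- `0 < θ` in a rough regime. [folklore] -/
theorem FIRegimeRough.θ_pos {A : SieveSequence} {D : ℝ → ℝ} {α θ θ₁ : ℝ} {lam : ℝ → ℕ → ℤ}
    {P : ℝ → ℝ} (h : FIRegimeRough A D α θ θ₁ lam P) : 0 < θ := by
  linarith [h.θ₁_pos, h.θ₁_le]

/-! ### The term estimates over the core and rough regimes -/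

/-- **(4.5) `T(x; y) = HA(x) + O(A(x)(log x)^{-2})` over `FIRegimeCore`**: as `fi_asp_T_estimate`,
for the hypotheses of Theorem 1 with arbitrary bilinear parameters `δ, Δ` (FI's proof of (4.5),
§4, uses (R′) — `Δy < D` — and (2.4), (1.13)–(1.14), never (B)). The tree's proof
(`fi_asp_T_estimate_of_cancellation`) reads `δ, Δ` only through `FIRegime.hyp`, so it discharges this
`Prop` verbatim once its regime argument is generalised to `FIRegimeCore` (the intended discharge;
likewise for (5.1), (6.6) below). [cite: FriedlanderIwaniecASP1998, §4 (4.5)] -/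
def fi_asp_T_estimate_core : Prop :=
  ∀ (A : SieveSequence) (D δ Δ : ℝ → ℝ) (α θ θ₁ : ℝ) (lam : ℝ → ℕ → ℤ) (H : ℝ),
    FIRegimeCore A D δ Δ α θ θ₁ lam → A.HasDensityConstant H →
      ∃ K : ℝ, ∀ᶠ x : ℝ in atTop, ∀ y : ℝ, fiY D θ x ≤ y → y ≤ Real.exp 1 * fiY D θ x →
        |A.fiT (lam x) x y - H * A.size x| ≤ K * A.size x / Real.log x ^ 2

/-- **(5.1) `T(x; y, z) ≪ A(x)(log x)^{-2}` over `FIRegimeCore`** (as `fi_asp_Tyz_estimate`; FI §5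
uses (2.4), (1.8) and (R′) — `yz < Δ⁻¹D` — never (B)). [cite: FriedlanderIwaniecASP1998, §5 (5.1)] -/
def fi_asp_Tyz_estimate_core : Prop :=
  ∀ (A : SieveSequence) (D δ Δ : ℝ → ℝ) (α θ θ₁ : ℝ) (lam : ℝ → ℕ → ℤ),
    FIRegimeCore A D δ Δ α θ θ₁ lam →
      ∃ K : ℝ, ∀ᶠ x : ℝ in atTop, ∀ y : ℝ, fiY D θ x ≤ y → y ≤ Real.exp 1 * fiY D θ x →
        ∀ z : ℝ, fiY D θ x ≤ z → z ≤ Real.exp 1 * fiY D θ x →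
          |A.fiTyz (lam x) x y z| ≤ K * A.size x / Real.log x ^ 2

/-- **(6.6) `S₁(x; y, z) ≪ A(x) log δ/log Δ` over `FIRegimeCore`** (as `fi_asp_S1_estimate`,
including its sieve-bound hypothesis on the weights; FI §6 uses (R′), (1.8), (1.9) and the
upper-bound sieve, never (B)). [cite: FriedlanderIwaniecASP1998, §6 (6.6)] -/
def fi_asp_S1_estimate_core : Prop :=
  ∀ (A : SieveSequence) (D δ Δ : ℝ → ℝ) (α θ θ₁ : ℝ) (lam : ℝ → ℕ → ℤ),
    FIRegimeCore A D δ Δ α θ θ₁ lam →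
    (∃ C : ℝ, ∀ᶠ x : ℝ in atTop, ∀ ε : ℝ, 0 < ε → ε ≤ 1 →
      ∑ d ∈ (primesProdBelow (x ^ θ₁)).divisors,
          (lam x d : ℝ) * ∏ p ∈ d.primeFactors, fiSieveDensity A.density ε p ≤
        C * ∏ p ∈ Nat.primesBelow ⌈x ^ θ₁⌉₊, (1 - fiSieveDensity A.density ε p)) →
      ∃ K : ℝ, ∀ᶠ x : ℝ in atTop, ∀ s : ℝ, IsFISplit D α θ x s →
        ∀ y : ℝ, fiY D θ x ≤ y → y ≤ Real.exp 1 * fiY D θ x →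
        ∀ z : ℝ, fiY D θ x ≤ z → z ≤ Real.exp 1 * fiY D θ x →
          |A.fiS1 (lam x) s x y z| ≤ K * A.size x * Real.log (Real.log x) / Real.log x

/-- The core form of (4.5) implies the tree's `fi_asp_T_estimate`. [folklore] -/
theorem fi_asp_T_estimate_core.to_estimate (h : fi_asp_T_estimate_core) : fi_asp_T_estimate :=
  fun A D α θ θ₁ lam H hreg hH => h A D _ _ α θ θ₁ lam H hreg.toCore hH

/-- The core form of (5.1) implies the tree's `fi_asp_Tyz_estimate`. [folklore] -/
theorem fi_asp_Tyz_estimate_core.to_estimate (h : fi_asp_Tyz_estimate_core) :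
    fi_asp_Tyz_estimate :=
  fun A D α θ θ₁ lam hreg => h A D _ _ α θ θ₁ lam hreg.toCore

/-- The core form of (6.6) implies the tree's `fi_asp_S1_estimate`. [folklore] -/
theorem fi_asp_S1_estimate_core.to_estimate (h : fi_asp_S1_estimate_core) : fi_asp_S1_estimate :=
  fun A D α θ θ₁ lam hreg hB => h A D _ _ α θ θ₁ lam hreg.toCore hB

/-- **(7.2) `S₂(x; Y, z) ≪ A(x)(log x)^{-1}` under (B*)** (over `FIRegimeRough`): FI §10, "In the
case of `S₂` we note that (7.1) contains such an integration with `y` in place of `w` and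
`γ(n, t) = 1`", i.e. (7.2) follows from the integrated bound (B̃), itself a consequence of (B*)
((10.4)–(10.5)). [cite: FriedlanderIwaniecASP1998, §7 (7.2) and §10 (10.5)] -/
def fi_asp_S2_estimate_rough : Prop :=
  ∀ (A : SieveSequence) (D : ℝ → ℝ) (α θ θ₁ : ℝ) (lam : ℝ → ℕ → ℤ) (P : ℝ → ℝ),
    FIRegimeRough A D α θ θ₁ lam P →
      ∃ K : ℝ, ∀ᶠ x : ℝ in atTop, ∀ s : ℝ, IsFISplit D α θ x s →
        ∀ z : ℝ, fiY D θ x ≤ z → z ≤ Real.exp 1 * fiY D θ x →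
          |A.fiS2Y (lam x) s x (fiY D θ x) z| ≤ K * A.size x / Real.log x

/-- **(8.5) `S₃(x; y, Z) ≪ A(x)(log x)^{-1}` under (B*)** (over `FIRegimeRough`): FI §10, "In the
case of `S₃` we note that (8.1) may be integrated over `z` in place of `w` and there `λ⁻(c)` is the
integral of `γ(c, t)` as required." [cite: FriedlanderIwaniecASP1998, §8 (8.5) and §10 (10.5)] -/
def fi_asp_S3_estimate_rough : Prop :=
  ∀ (A : SieveSequence) (D : ℝ → ℝ) (α θ θ₁ : ℝ) (lam : ℝ → ℕ → ℤ) (P : ℝ → ℝ),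
    FIRegimeRough A D α θ θ₁ lam P →
      ∃ K : ℝ, ∀ᶠ x : ℝ in atTop, ∀ s : ℝ, IsFISplit D α θ x s →
        ∀ y : ℝ, fiY D θ x ≤ y → y ≤ Real.exp 1 * fiY D θ x →
          |A.fiS3Z (lam x) s x y (fiY D θ x)| ≤ K * A.size x / Real.log x

/-! ### Theorem 1 with (B*) in place of (B) (named fact: the statement proved in §10) -/

/-- **Friedlander–Iwaniec, asymptotic sieve for primes: Theorem 1 with the bilinear hypothesis
(B) replaced by (B*)** — the statement established in [FriedlanderIwaniecASP1998] §10,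
pp. 1063–1064, in the course of the proof of Theorem 3 ("For the proof it is enough to show that
(B*) implies (B) with `δ, Δ` replaced by `2δ, 2Δ²`. Furthermore we only need to establish (B) in the
following integrated form (B̃) … recall that (B) was used solely to estimate the sums `S₂` and `S₃`
in Sections 7 and 8"). It is NOT the printed Theorem 3, whose hypotheses (those of Theorem 2) also
contain (9.1), (9.2), (R₃) — not used by Theorem 1's proof and dropped here — and it is the case of
[FriedlanderIwaniecAnnals1998] Proposition 2.1 that the tree applies (to `μ²(n)a_n`). Regime:
`δ = (log x)^α`, `Δ = x^θ` (`α > 0`, `0 < θ < 1/3`) as in `Literature.NumberTheory.Sieve.fi_asymptotic_sieve_primes_loglog`.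
Let `A = (a_n)`, `a_n ≥ 0`, be supported on squarefree
integers and satisfy (1.4), (1.6), (1.8), (1.9), (R) with `x^{2/3} < D < x`, and, for a parameter
`2 ≤ P = P(x) ≤ Δ^{1/(2^{35} log log x)}` ((10.2)), the bound
(B*) `∑_m |∑_{N<n≤2N, mn≤x, (n,Π)=1} γ(n,C) μ(mn) a_{mn}| ≤ A(x)(log x)^{-2^{26}}` (`Π = ∏_{p<P} p`)
for all `Δ⁻¹√D < N < δ⁻¹√x`, `1 ≤ C ≤ x/D` (`SieveSequence.FIAsymptoticSieveHypothesesRough`); let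
`H = ∏_p (1 - g(p))(1 - 1/p)⁻¹` (`SieveSequence.HasDensityConstant`). Then
`∑_{p ≤ x} a_p log p = H A(x)(1 + O(log log x / log x))` (FI p. 1044 for the regime). The `IsBigO`
constant may depend on everything fixed. Not yet proved in the tree: its proof is Theorem 1's
(`fi_asymptotic_sieve_primes_loglog_of_cancellation`), run in the regime `FIRegimeRough` with
structural exponent `θ/2`, with (7.2), (8.5) re-derived from the integrated form (B̃) of §10
(`fi_asp_S2_estimate_rough`, `fi_asp_S3_estimate_rough`).
[cite: FriedlanderIwaniecASP1998, §10 pp. 1063-1064 (proof of Theorem 3); Theorem 1 (1.17), p. 1044] -/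
def fi_asymptotic_sieve_primes_rough_loglog : Prop :=
  ∀ (A : SieveSequence) (D P : ℝ → ℝ) (α θ H : ℝ), 0 < α → 0 < θ → θ < 1 / 3 →
    A.FIAsymptoticSieveHypothesesRough D (fun x => Real.log x ^ α) (fun x => x ^ θ) P →
      A.HasDensityConstant H →
      (fun x : ℝ => (∑ p ∈ Nat.primesLE ⌊x⌋₊, A.a p * Real.log p) - H * A.size x) =O[atTop]
        fun x : ℝ => H * A.size x * (Real.log (Real.log x) / Real.log x)

end Literature.NumberTheory.Sieve
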